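import Literature.Probability.RandomPlanarGeometry.SAWAdsorptionUpperBound
import Mathlib.Analysis.MeanInequalities
import HarnessLib

/-!
# Log-convexity of the adsorption partition function in the fugacity

Topic `Literature/Probability/RandomPlanarGeometry` (continues `SAWAdsorptionUpperBound.lean`: `hpWalks`, `wallVisits`,
`adsZ n a = Z⁺_n(a) = Σ_ω a^{v(ω)}`).

Hammersley–Torrie–Whittington 1982 (reported in Beaton–Guttmann–Jensen 2012, §1 p. 2): the adsorption free energy
`κ(α)` «is a convex, non-decreasing function of `α`» (`a = e^α`). The finite-volume fact behind convexity is Hölder's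
inequality for the polynomial `Z⁺_n` with nonnegative coefficients: **`Z⁺_n(a^θ b^{1-θ}) ≤ Z⁺_n(a)^θ Z⁺_n(b)^{1-θ}`**
for `a, b > 0`, `0 < θ < 1` (`Zd.adsZ_rpow_mul_rpow_le`), i.e. `α ↦ log Z⁺_n(e^α)` is convex for every `n`; hence so is
every limit or limsup `κ`. (Monotonicity in `a` is `Zd.adsZ_mono`, `SAWAdsorptionDesorbedPhase.lean`.) Pure standard axioms.
-/

open Finset
open scoped BigOperators

namespace Literature.Probability.RandomPlanarGeometry.SAW.Zd

/-- **Hölder / log-convexity of `Z⁺_n` in `log a`**: `Z⁺_n(a^θ b^{1-θ}) ≤ Z⁺_n(a)^θ · Z⁺_n(b)^{1-θ}` for `a, b > 0` and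
`0 < θ < 1`. [cite: BeatonGuttmannJensen2012Adsorption, §1 (p. 2)] -/
theorem adsZ_rpow_mul_rpow_le (n : ℕ) {a b θ : ℝ} (ha : 0 < a) (hb : 0 < b) (hθ0 : 0 < θ) (hθ1 : θ < 1) :
    adsZ n (a ^ θ * b ^ (1 - θ)) ≤ adsZ n a ^ θ * adsZ n b ^ (1 - θ) := by
  have h1θ : 0 < 1 - θ := by linarith
  have hpq : (1 / θ).HolderConjugate (1 / (1 - θ)) := Real.holderConjugate_one_div hθ0 h1θ (by ring)
  -- the summand splits as `(a^v)^θ · (b^v)^{1-θ}`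
  have hsplit : ∀ v : ℕ, (a ^ θ * b ^ (1 - θ)) ^ v = (a ^ v) ^ θ * (b ^ v) ^ (1 - θ) := by
    intro v
    rw [mul_pow, ← Real.rpow_natCast (a ^ θ), ← Real.rpow_natCast (b ^ (1 - θ)), ← Real.rpow_mul ha.le,
      ← Real.rpow_mul hb.le, mul_comm θ, mul_comm (1 - θ), Real.rpow_mul ha.le, Real.rpow_mul hb.le,
      Real.rpow_natCast, Real.rpow_natCast]
  unfold adsZ
  simp_rw [hsplit]
  have hH := Real.inner_le_Lp_mul_Lq_of_nonneg (hpWalks n) hpq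
    (f := fun ω => (a ^ wallVisits n ω) ^ θ) (g := fun ω => (b ^ wallVisits n ω) ^ (1 - θ))
    (fun ω _ => Real.rpow_nonneg (pow_nonneg ha.le _) _) (fun ω _ => Real.rpow_nonneg (pow_nonneg hb.le _) _)
  -- `((a^v)^θ)^{1/θ} = a^v`, `((b^v)^{1-θ})^{1/(1-θ)} = b^v`
  have hf : ∀ ω, ((a ^ wallVisits n ω) ^ θ) ^ (1 / θ) = a ^ wallVisits n ω := fun ω => by
    rw [← Real.rpow_mul (pow_nonneg ha.le _), mul_one_div_cancel hθ0.ne', Real.rpow_one]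
  have hg : ∀ ω, ((b ^ wallVisits n ω) ^ (1 - θ)) ^ (1 / (1 - θ)) = b ^ wallVisits n ω := fun ω => by
    rw [← Real.rpow_mul (pow_nonneg hb.le _), mul_one_div_cancel h1θ.ne', Real.rpow_one]
  simp only [hf, hg, one_div_one_div] at hH
  exact hH

end Literature.Probability.RandomPlanarGeometry.SAW.Zd
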